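import Literature.GroupTheory.CombinatorialGroupTheory.PuncturedSurfaceGroupUnmarkedLevelBases
import HarnessLib

/-!
# The node loop and the cusp `c_0` of an unmarked-component degeneration as MEMBERS of a level basis

Topic `Literature/GroupTheory/CombinatorialGroupTheory`; theorems only; sequel to
`PuncturedSurfaceGroupUnmarkedLevelBases.lean` (same setting: `Γ = Γ_{g,r'+1}`, `c_0`-eliminating basis `b₀`,
level `K = Ker(χ)` of the character `a_{g₀} ↦ 1 ∈ ℤ/n`, abc-iut-w5-d174's Schreier basis `bK` of `K` with
`Y_{x,k} = t^k x t^{-k}`, `T = t^n`, `t = a_{g₀}` [cite: LyndonSchupp2001, Ch. I Prop. 3.7]).  Two Nielsen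
moves (Lyndon–Schupp I.3 Prop. 3.8 [cite: LyndonSchupp2001, I.3 Prop 3.8]; abc-iut-f-166's
`exists_freeGroupBasis_update_mul`, abc-iut-f-164's `exists_freeGroupBasis_update_mul_inv`), for `n ≥ 2`:

* `exists_levelBasis_secondHandleProd` — replacing the member `Y_{b_{g₀},1}` by
  `w = ∏_{i≥g₀}[a_i,b_i] = Y_{b_{g₀},1} · Y_{b_{g₀},0}⁻¹ · ∏_{i>g₀}[Y_{a_i,0}, Y_{b_i,0}]` gives a free basis of
  `K` containing `w` — the node loop (inverted) of the two-component degeneration with `C₁` unmarked;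
* `exists_levelBasis_cuspZero` — replacing it instead by
  `c_0 = (∏_{i>g₀}[…])⁻¹ Y_{b_{g₀},0} Y_{b_{g₀},1}⁻¹ (∏_{i<g₀}[…])⁻¹ (c_1⋯c_{r'})⁻¹` gives a free basis containing
  `c_0` (at `r' = 0` the cusp `c_0` of `Γ_{g,1}` is a product of commutators and belongs to no basis of `Γ`).

Membership of words in sub-basis closures is checked in `Γ` through the injection `K ↪ Γ`
(`mem_closure_levelBasis_iff`).  Elementary combinatorial group theory; nothing here concerns [IUTchIII].
-/

namespace Literature.GroupTheory.CombinatorialGroupTheory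

namespace PuncturedSurfaceGroup

open Multiplicative

section Nielsen

variable {g r' g₀ n : ℕ} (hg : g₀ < g) [Fact (1 < n)]
variable (b₀ : FreeGroupBasis ((Fin g × Bool) ⊕ Fin r') (PuncturedSurfaceGroup g (r' + 1)))
variable (ha : ∀ i, b₀ (Sum.inl (i, false)) = a i) (hb : ∀ i, b₀ (Sum.inl (i, true)) = b i)
variable (hc : ∀ j : Fin r', b₀ (Sum.inr j) = c (Fin.succ j))
variable (χ : PuncturedSurfaceGroup g (r' + 1) →* Multiplicative (ZMod n))
variable (hχa : ∀ i : Fin g, χ (a i) = if (i : ℕ) = g₀ then ofAdd 1 else 1)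
variable (hχb : ∀ i : Fin g, χ (b i) = 1) (hχc : ∀ j : Fin (r' + 1), χ (c j) = 1)
variable (bK : FreeGroupBasis (({x : (Fin g × Bool) ⊕ Fin r' // x ≠ Sum.inl (⟨g₀, hg⟩, false)} × ZMod n) ⊕
    Unit) χ.ker)
variable (hbK : ∀ (x : {x : (Fin g × Bool) ⊕ Fin r' // x ≠ Sum.inl (⟨g₀, hg⟩, false)}) (k : ZMod n),
    ((bK (Sum.inl (x, k)) : χ.ker) : PuncturedSurfaceGroup g (r' + 1)) =
      b₀ (Sum.inl (⟨g₀, hg⟩, false)) ^ k.val * b₀ x.1 * (b₀ (Sum.inl (⟨g₀, hg⟩, false)) ^ k.val)⁻¹)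

omit [Fact (1 < n)] in
/-- Membership in a sub-basis closure of the level is read in `Γ` (the inclusion `K ↪ Γ` is injective).
[cite: LyndonSchupp2001, Ch. I Prop. 3.7] -/
theorem mem_closure_levelBasis_iff
    (S : Set (({x : (Fin g × Bool) ⊕ Fin r' // x ≠ Sum.inl (⟨g₀, hg⟩, false)} × ZMod n) ⊕ Unit))
    (x : χ.ker) :
    x ∈ Subgroup.closure (bK '' S) ↔
      (x : PuncturedSurfaceGroup g (r' + 1)) ∈
        Subgroup.closure ((fun i => ((bK i : χ.ker) : PuncturedSurfaceGroup g (r' + 1))) '' S) := by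
  rw [← FreeGroupBasis.map_subtype_closure_image, ← Subgroup.coe_subtype]
  exact (Subgroup.mem_map_iff_mem Subtype.val_injective).symm

omit [Fact (1 < n)] in
include ha hb hbK in
/-- The level-`0` letters: `Y_{a_i,0} = a_i`, `Y_{b_i,0} = b_i` (`i ≠ g₀` for `a_i`).
[cite: LyndonSchupp2001, Ch. I Prop. 3.7] -/
theorem levelBasis_zero_handles (i : Fin g) :
    (∀ hi : Sum.inl (i, false) ≠ (Sum.inl (⟨g₀, hg⟩, false) : (Fin g × Bool) ⊕ Fin r'),
      ((bK (Sum.inl (⟨Sum.inl (i, false), hi⟩, 0)) : χ.ker) : PuncturedSurfaceGroup g (r' + 1)) = a i) ∧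
    ((bK (Sum.inl (⟨Sum.inl (i, true), by simp⟩, 0)) : χ.ker) : PuncturedSurfaceGroup g (r' + 1)) = b i := by
  refine ⟨fun hi => ?_, ?_⟩
  · rw [hbK, ZMod.val_zero, pow_zero, inv_one, one_mul, mul_one, ha]
  · rw [hbK, ZMod.val_zero, pow_zero, inv_one, one_mul, mul_one, hb]

omit [Fact (1 < n)] in
include hc hbK in
/-- The level-`0` cusp letters: `Y_{c_{j+1},0} = c_{j+1}`. [cite: LyndonSchupp2001, Ch. I Prop. 3.7] -/
theorem levelBasis_zero_cusp (j : Fin r') :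
    ((bK (Sum.inl (⟨Sum.inr j, by simp⟩, 0)) : χ.ker) : PuncturedSurfaceGroup g (r' + 1)) = c (Fin.succ j) := by
  rw [hbK, ZMod.val_zero, pow_zero, inv_one, one_mul, mul_one, hc]

omit [Fact (1 < n)] in
include ha hb hbK in
/-- A padded handle product avoiding the handle `g₀` lies in the closure of the level-`0` letters it uses.
[cite: LyndonSchupp2001, Ch. I Prop. 3.7] -/
theorem comm_prod_mem_closure_levelZero (p : Fin g → Prop) [DecidablePred p] (hp : ∀ i, p i → (i : ℕ) ≠ g₀)
    (S : Set (({x : (Fin g × Bool) ⊕ Fin r' // x ≠ Sum.inl (⟨g₀, hg⟩, false)} × ZMod n) ⊕ Unit))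
    (hS : ∀ (i : Fin g) (bit : Bool) (hi : Sum.inl (i, bit) ≠ (Sum.inl (⟨g₀, hg⟩, false) :
      (Fin g × Bool) ⊕ Fin r')), p i → Sum.inl (⟨Sum.inl (i, bit), hi⟩, (0 : ZMod n)) ∈ S) :
    ((List.finRange g).map fun i : Fin g => if p i then
        a (r := r' + 1) i * b i * (a i)⁻¹ * (b i)⁻¹ else 1).prod ∈
      Subgroup.closure ((fun i => ((bK i : χ.ker) : PuncturedSurfaceGroup g (r' + 1))) '' S) := by
  refine comm_prod_ite_mem _ _ (fun i hi => ?_) (fun i hi => ?_)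
  · have hne : Sum.inl (i, false) ≠ (Sum.inl (⟨g₀, hg⟩, false) : (Fin g × Bool) ⊕ Fin r') := by
      intro h; simp only [Sum.inl.injEq, Prod.mk.injEq, and_true] at h
      exact hp i hi (by rw [h])
    rw [← (levelBasis_zero_handles hg b₀ ha hb χ bK hbK i).1 hne]
    exact Subgroup.subset_closure ⟨_, hS i false hne hi, rfl⟩
  · rw [← (levelBasis_zero_handles hg b₀ ha hb χ bK hbK i).2]
    exact Subgroup.subset_closure ⟨_, hS i true (by simp) hi, rfl⟩

include ha hb hχb hbK in
/-- **The node loop as a level basis member.**  For `n ≥ 2` there is a free basis `b'` of `K` with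
`b'(Y_{b_{g₀},1}\text{-slot}) = w = ∏_{i≥g₀}[a_i,b_i]` and `b' = bK` elsewhere (Nielsen move
`Y_{b_{g₀},1} ↦ Y_{b_{g₀},1}·(Y_{b_{g₀},0}⁻¹·∏_{i>g₀}[Y_{a_i,0},Y_{b_i,0}])`). [cite: LyndonSchupp2001, I.3 Prop 3.8] -/
theorem exists_levelBasis_secondHandleProd :
    ∃ b' : FreeGroupBasis (({x : (Fin g × Bool) ⊕ Fin r' // x ≠ Sum.inl (⟨g₀, hg⟩, false)} × ZMod n) ⊕ Unit)
        χ.ker,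
      ((b' (Sum.inl (⟨Sum.inl (⟨g₀, hg⟩, true), by simp⟩, 1)) : χ.ker) : PuncturedSurfaceGroup g (r' + 1)) =
        ((List.finRange g).map fun i : Fin g => if g₀ ≤ (i : ℕ) then
          a (r := r' + 1) i * b i * (a i)⁻¹ * (b i)⁻¹ else 1).prod ∧
      ∀ j, j ≠ Sum.inl (⟨Sum.inl (⟨g₀, hg⟩, true), by simp⟩, 1) → b' j = bK j := by
  classical
  set σ₁ : ({x : (Fin g × Bool) ⊕ Fin r' // x ≠ Sum.inl (⟨g₀, hg⟩, false)} × ZMod n) ⊕ Unit :=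
    Sum.inl (⟨Sum.inl (⟨g₀, hg⟩, true), by simp⟩, 1) with hσ₁
  set σ₀ : ({x : (Fin g × Bool) ⊕ Fin r' // x ≠ Sum.inl (⟨g₀, hg⟩, false)} × ZMod n) ⊕ Unit :=
    Sum.inl (⟨Sum.inl (⟨g₀, hg⟩, true), by simp⟩, 0) with hσ₀
  have h01 : σ₀ ≠ σ₁ := by
    rw [hσ₀, hσ₁]; simp
  have hu : ((List.finRange g).map fun i : Fin g => if g₀ + 1 ≤ (i : ℕ) then
      a (r := r' + 1) i * b i * (a i)⁻¹ * (b i)⁻¹ else 1).prod ∈ χ.ker := comm_prod_ite_mem_levelKer χ hχb _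
  -- the multiplier `Y_{b,0}⁻¹ · u`
  have hmem : (bK σ₀)⁻¹ * ⟨_, hu⟩ ∈ Subgroup.closure (bK '' {j | j ≠ σ₁}) := by
    refine Subgroup.mul_mem _ (Subgroup.inv_mem _ (Subgroup.subset_closure ⟨σ₀, h01, rfl⟩)) ?_
    rw [mem_closure_levelBasis_iff hg χ bK]
    exact comm_prod_mem_closure_levelZero hg b₀ ha hb χ bK hbK _ (fun i hi => by omega) _
      (fun i bit hi _ => by rw [hσ₁]; simp)
  obtain ⟨b', hb'σ, hb'⟩ := exists_freeGroupBasis_update_mul bK σ₁ _ hmem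
  refine ⟨b', ?_, hb'⟩
  rw [hb'σ, Subgroup.coe_mul, Subgroup.coe_mul, Subgroup.coe_inv, hbK, hbK, ZMod.val_one, ZMod.val_zero,
    pow_zero, pow_one, inv_one, one_mul, mul_one, ha, hb, secondHandleProd_eq_comm_mul hg]
  change _ * (_ * ((List.finRange g).map fun i : Fin g => if g₀ + 1 ≤ (i : ℕ) then
      a (r := r' + 1) i * b i * (a i)⁻¹ * (b i)⁻¹ else 1).prod) = _
  group

include ha hb hc hχb hχc hbK in
/-- **The cusp `c_0` as a level basis member.**  For `n ≥ 2` there is a free basis `b'` of `K` with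
`b'(Y_{b_{g₀},1}\text{-slot}) = c_0` and `b' = bK` elsewhere (two Nielsen moves:
`c_0 = [(∏_{i>g₀}[Y_{a_i,0},Y_{b_i,0}])⁻¹ Y_{b_{g₀},0}] · Y_{b_{g₀},1}⁻¹ · [(∏_{i<g₀}[Y_{a_i,0},Y_{b_i,0}])⁻¹ (Y_{c_1,0}⋯Y_{c_{r'},0})⁻¹]`).
[cite: LyndonSchupp2001, I.3 Prop 3.8] -/
theorem exists_levelBasis_cuspZero :
    ∃ b' : FreeGroupBasis (({x : (Fin g × Bool) ⊕ Fin r' // x ≠ Sum.inl (⟨g₀, hg⟩, false)} × ZMod n) ⊕ Unit)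
        χ.ker,
      ((b' (Sum.inl (⟨Sum.inl (⟨g₀, hg⟩, true), by simp⟩, 1)) : χ.ker) : PuncturedSurfaceGroup g (r' + 1)) =
        c 0 ∧
      ∀ j, j ≠ Sum.inl (⟨Sum.inl (⟨g₀, hg⟩, true), by simp⟩, 1) → b' j = bK j := by
  classical
  set σ₁ : ({x : (Fin g × Bool) ⊕ Fin r' // x ≠ Sum.inl (⟨g₀, hg⟩, false)} × ZMod n) ⊕ Unit :=
    Sum.inl (⟨Sum.inl (⟨g₀, hg⟩, true), by simp⟩, 1) with hσ₁
  set σ₀ : ({x : (Fin g × Bool) ⊕ Fin r' // x ≠ Sum.inl (⟨g₀, hg⟩, false)} × ZMod n) ⊕ Unit :=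
    Sum.inl (⟨Sum.inl (⟨g₀, hg⟩, true), by simp⟩, 0) with hσ₀
  have h01 : σ₀ ≠ σ₁ := by
    rw [hσ₀, hσ₁]; simp
  have hu : ((List.finRange g).map fun i : Fin g => if g₀ + 1 ≤ (i : ℕ) then
      a (r := r' + 1) i * b i * (a i)⁻¹ * (b i)⁻¹ else 1).prod ∈ χ.ker := comm_prod_ite_mem_levelKer χ hχb _
  have hv : ((List.finRange g).map fun i : Fin g => if (i : ℕ) < g₀ then
      a (r := r' + 1) i * b i * (a i)⁻¹ * (b i)⁻¹ else 1).prod ∈ χ.ker := comm_prod_ite_mem_levelKer χ hχb _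
  have hC : ((List.finRange (r' + 1)).map fun j : Fin (r' + 1) =>
      if 1 ≤ (j : ℕ) then c (g := g) j else 1).prod ∈ χ.ker :=
    prod_map_finRange_ite_mem _ _ _ _ fun j _ => c_mem_levelKer χ hχc j
  -- the cusp block lies in the closure of the level-`0` cusp letters
  have hCcl : ((List.finRange (r' + 1)).map fun j : Fin (r' + 1) =>
      if 1 ≤ (j : ℕ) then c (g := g) j else 1).prod ∈
      Subgroup.closure ((fun i => ((bK i : χ.ker) : PuncturedSurfaceGroup g (r' + 1))) '' {j | j ≠ σ₁}) := by
    refine prod_map_finRange_ite_mem _ _ _ _ fun j hj => ?_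
    have hj' : j = Fin.succ (j.pred (by intro h; rw [h] at hj; exact absurd hj (by simp))) := by
      rw [Fin.succ_pred]
    rw [hj', ← levelBasis_zero_cusp hg b₀ hc χ bK hbK]
    exact Subgroup.subset_closure ⟨_, by rw [hσ₁]; simp, rfl⟩
  -- first move: `Y_{b,1} ↦ (u⁻¹ Y_{b,0}) · Y_{b,1}⁻¹`
  have hmem₁ : (⟨_, hu⟩ : χ.ker)⁻¹ * bK σ₀ ∈ Subgroup.closure (bK '' {j | j ≠ σ₁}) := by
    refine Subgroup.mul_mem _ (Subgroup.inv_mem _ ?_) (Subgroup.subset_closure ⟨σ₀, h01, rfl⟩)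
    rw [mem_closure_levelBasis_iff hg χ bK]
    exact comm_prod_mem_closure_levelZero hg b₀ ha hb χ bK hbK _ (fun i hi => by omega) _
      (fun i bit hi _ => by rw [hσ₁]; simp)
  obtain ⟨b₁, hb₁σ, hb₁⟩ := exists_freeGroupBasis_update_mul_inv bK σ₁ _ hmem₁
  -- second move: `· ↦ · v⁻¹ C⁻¹`
  have hmem₂ : (⟨_, hv⟩ : χ.ker)⁻¹ * (⟨_, hC⟩ : χ.ker)⁻¹ ∈ Subgroup.closure (b₁ '' {j | j ≠ σ₁}) := by
    have hcl : Subgroup.closure (b₁ '' {j | j ≠ σ₁}) = Subgroup.closure (bK '' {j | j ≠ σ₁}) :=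
      closure_image_congr fun j hj => hb₁ j hj
    rw [hcl]
    refine Subgroup.mul_mem _ (Subgroup.inv_mem _ ?_) (Subgroup.inv_mem _ ?_)
    · rw [mem_closure_levelBasis_iff hg χ bK]
      exact comm_prod_mem_closure_levelZero hg b₀ ha hb χ bK hbK _ (fun i hi => by omega) _
        (fun i bit hi _ => by rw [hσ₁]; simp)
    · rw [mem_closure_levelBasis_iff hg χ bK]
      exact hCcl
  obtain ⟨b₂, hb₂σ, hb₂⟩ := exists_freeGroupBasis_update_mul b₁ σ₁ _ hmem₂
  refine ⟨b₂, ?_, fun j hj => by rw [hb₂ j hj, hb₁ j hj]⟩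
  rw [hb₂σ, hb₁σ, Subgroup.coe_mul, Subgroup.coe_mul, Subgroup.coe_mul, Subgroup.coe_mul, Subgroup.coe_inv,
    Subgroup.coe_inv, Subgroup.coe_inv, Subgroup.coe_inv, hbK, hbK, ZMod.val_one, ZMod.val_zero, pow_zero,
    pow_one, inv_one, one_mul, mul_one, ha, hb, c_zero_eq_inv_mul g₀, secondHandleProd_eq_comm_mul hg]
  change (((List.finRange g).map fun i : Fin g => if g₀ + 1 ≤ (i : ℕ) then
      a (r := r' + 1) i * b i * (a i)⁻¹ * (b i)⁻¹ else 1).prod)⁻¹ * _ * _ * ((((List.finRange g).map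
      fun i : Fin g => if (i : ℕ) < g₀ then a (r := r' + 1) i * b i * (a i)⁻¹ * (b i)⁻¹ else 1).prod)⁻¹ *
      (((List.finRange (r' + 1)).map fun j : Fin (r' + 1) => if 1 ≤ (j : ℕ) then c (g := g) j else 1).prod)⁻¹) = _
  group

end Nielsen

end PuncturedSurfaceGroup

end Literature.GroupTheory.CombinatorialGroupTheory
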